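import Mathlib
import Summits.ValiantsHypothesis.ValiantsHypothesis.Theorems.ProofCarryingSymmetryRestorationQPACStabilityPF

/-!
# Route ProofCarryingSymmetry — crux `RestorationQP`, line `registered`, rung S3‴ under stub S2″ (`stub_proofsToACEquiv`), part 1:
Hrubeš–Tzameret formulas modulo associativity, commutativity and the unit laws

The registered stability rung S3″ (`stub_stabilityAtACEquiv`, `…ACStabilityPF.lean`) turns
invariance proofs avoiding A6–A10 into `S_n`-symmetric Dawar–Wilsenach circuits.  Rung S3‴ weakens
the hypothesis: the invariance proofs may also use the UNIT LAWS A7 `F + 0 = F`, A8 `F · 0 = 0`,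
A9 `F · 1 = F`, avoiding only distributivity A6 and the constant equations A10.  This file is the
term-level groundwork, for formulas `PIFormula 𝔽 X`:

* `UEq` — the congruence generated by A1–A5 and A7–A9 (the "ACU fragment" of `P_f`); it contains
  `ACEq` (`ACEq.toUEq`), preserves `eval` (`UEq.eval_eq`) and is stable under renaming
  (`UEq.rename`);
* `IsDistConst s` — the excluded schemes A6, A10;
* ACU-SOUNDNESS: a `P_f` proof with no instance of A6/A10 relates `UEq`-equivalent formulas
  (`uEq_of_pfProof`, `uEq_of_pfProvable`), and a `P_c` proof with no instance of A6/A10 relates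
  circuits with `UEq`-equivalent unfoldings (`uEq_unfold_of_pcProof`, `uEq_unfold_of_hasPCProof`;
  C1/C2 instances have equal unfoldings, `PICircuit.IsExtra.unfold_eq`).

The normaliser absorbing the unit laws into AC-classes is part 2 (`…UnitNorm.lean`), the symmetric
circuit part 3 (`…UnitStability.lean`).  Everything is elementary and proved; no named facts.
(HT = Hrubeš–Tzameret, arXiv:1112.6265 §1.1.)
-/

-- single-problem summit: `Summit.ValiantsHypothesis.ValiantsHypothesis.…` is the namespace by design (D-0017)
set_option linter.dupNamespace false

namespace Summit.ValiantsHypothesis.ValiantsHypothesis.Theorems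

namespace ACStability

open Literature.Computability.AlgebraicComplexity

universe u v w

variable {𝔽 : Type u} {X : Type v} {Y : Type w}

/-! ### The ACU congruence -/

section Defs

variable [Zero 𝔽] [One 𝔽]

/-- `UEq F G`: `F = G` is derivable in the fragment of Hrubeš–Tzameret's `P_f` with the axioms
A1–A5 (reflexivity, commutativity and associativity of `+` and `×`), the unit laws A7 `F + 0 = F`,
A8 `F · 0 = 0`, A9 `F · 1 = F`, and the rules R1–R4 — equality of formulas modulo associativity,
commutativity and units. [folklore] -/
inductive UEq : PIFormula 𝔽 X → PIFormula 𝔽 X → Prop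
  /-- A1 -/
  | refl (F : PIFormula 𝔽 X) : UEq F F
  /-- R1 -/
  | symm {F G : PIFormula 𝔽 X} : UEq F G → UEq G F
  /-- R2 -/
  | trans {F G H : PIFormula 𝔽 X} : UEq F G → UEq G H → UEq F H
  /-- R3 -/
  | add_congr {F F' G G' : PIFormula 𝔽 X} : UEq F F' → UEq G G' → UEq (.add F G) (.add F' G')
  /-- R4 -/
  | mul_congr {F F' G G' : PIFormula 𝔽 X} : UEq F F' → UEq G G' → UEq (.mul F G) (.mul F' G')
  /-- A2 -/
  | add_comm (F G : PIFormula 𝔽 X) : UEq (.add F G) (.add G F)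
  /-- A3 -/
  | add_assoc (F G H : PIFormula 𝔽 X) : UEq (.add F (.add G H)) (.add (.add F G) H)
  /-- A4 -/
  | mul_comm (F G : PIFormula 𝔽 X) : UEq (.mul F G) (.mul G F)
  /-- A5 -/
  | mul_assoc (F G H : PIFormula 𝔽 X) : UEq (.mul F (.mul G H)) (.mul (.mul F G) H)
  /-- A7 -/
  | add_zero (F : PIFormula 𝔽 X) : UEq (.add F (.const 0)) F
  /-- A8 -/
  | mul_zero (F : PIFormula 𝔽 X) : UEq (.mul F (.const 0)) (.const 0)
  /-- A9 -/
  | mul_one (F : PIFormula 𝔽 X) : UEq (.mul F (.const 1)) F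

/-- AC-equivalent formulas are ACU-equivalent. [folklore] -/
theorem ACEq.toUEq {F G : PIFormula 𝔽 X} (h : ACEq F G) : UEq F G := by
  induction h with
  | refl F => exact .refl _
  | symm _ ih => exact ih.symm
  | trans _ _ ih₁ ih₂ => exact ih₁.trans ih₂
  | add_congr _ _ ih₁ ih₂ => exact .add_congr ih₁ ih₂
  | mul_congr _ _ ih₁ ih₂ => exact .mul_congr ih₁ ih₂
  | add_comm F G => exact .add_comm _ _
  | add_assoc F G H => exact .add_assoc _ _ _
  | mul_comm F G => exact .mul_comm _ _
  | mul_assoc F G H => exact .mul_assoc _ _ _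

/-- `UEq` is stable under renaming of the variables. [folklore] -/
theorem UEq.rename (f : X → Y) {F G : PIFormula 𝔽 X} (h : UEq F G) :
    UEq (F.rename f) (G.rename f) := by
  induction h with
  | refl F => exact .refl _
  | symm _ ih => exact ih.symm
  | trans _ _ ih₁ ih₂ => exact ih₁.trans ih₂
  | add_congr _ _ ih₁ ih₂ => exact .add_congr ih₁ ih₂
  | mul_congr _ _ ih₁ ih₂ => exact .mul_congr ih₁ ih₂
  | add_comm F G => exact .add_comm _ _
  | add_assoc F G H => exact .add_assoc _ _ _
  | mul_comm F G => exact .mul_comm _ _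
  | mul_assoc F G H => exact .mul_assoc _ _ _
  | add_zero F => exact .add_zero _
  | mul_zero F => exact .mul_zero _
  | mul_one F => exact .mul_one _

/-- The left unit laws, derived: `0 + F ≡ F`. [folklore] -/
theorem UEq.zero_add (F : PIFormula 𝔽 X) : UEq (.add (.const 0) F) F :=
  (UEq.add_comm _ _).trans (.add_zero F)

/-- The left unit laws, derived: `0 · F ≡ 0`. [folklore] -/
theorem UEq.zero_mul (F : PIFormula 𝔽 X) : UEq (.mul (.const 0) F) (.const 0) :=
  (UEq.mul_comm _ _).trans (.mul_zero F)

/-- The left unit laws, derived: `1 · F ≡ F`. [folklore] -/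
theorem UEq.one_mul (F : PIFormula 𝔽 X) : UEq (.mul (.const 1) F) F :=
  (UEq.mul_comm _ _).trans (.mul_one F)

end Defs

/-! ### Soundness -/

section Sound

variable [CommSemiring 𝔽]

/-- ACU-equivalent formulas compute the same polynomial (soundness of A2–A5, A7–A9). [folklore] -/
theorem UEq.eval_eq {F G : PIFormula 𝔽 X} (h : UEq F G) : F.eval = G.eval := by
  induction h with
  | refl F => rfl
  | symm _ ih => exact ih.symm
  | trans _ _ ih₁ ih₂ => exact ih₁.trans ih₂
  | add_congr _ _ ih₁ ih₂ => simp [ih₁, ih₂]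
  | mul_congr _ _ ih₁ ih₂ => simp [ih₁, ih₂]
  | add_comm F G => simpa using _root_.add_comm F.eval G.eval
  | add_assoc F G H => simpa using (_root_.add_assoc F.eval G.eval H.eval).symm
  | mul_comm F G => simpa using _root_.mul_comm F.eval G.eval
  | mul_assoc F G H => simpa using (_root_.mul_assoc F.eval G.eval H.eval).symm
  | add_zero F => simp
  | mul_zero F => simp
  | mul_one F => simp

/-- The schemes outside the ACU fragment: A6 (distributivity) and A10 (constant equations).
[folklore] -/
def IsDistConst (s : PIAxiom) : Prop :=
  s = PIAxiom.A6 ∨ s = PIAxiom.A10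

/-- A6 and A10 are among A6–A10: a budget vanishing on A6–A10 vanishes on A6, A10. [folklore] -/
theorem IsDistConst.isNonAC {s : PIAxiom} (hs : IsDistConst s) : IsNonAC s := by
  rcases hs with rfl | rfl
  · exact Or.inl rfl
  · exact Or.inr (Or.inr (Or.inr (Or.inr rfl)))

/-! #### `P_f` -/

/-- An A1–A5 / A7–A9 instance on formulas relates ACU-equivalent formulas. [folklore] -/
theorem uEq_of_ringAxiom_pf {s : PIAxiom} (hs : ¬ IsDistConst s) {F G : PIFormula 𝔽 X}
    (h : (pfSystem 𝔽 X).RingAxiom s F G) : UEq F G := by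
  cases h with
  | a1 F => exact .refl _
  | a2 F G => exact UEq.add_comm F G
  | a3 F G H => exact UEq.add_assoc F G H
  | a4 F G => exact UEq.mul_comm F G
  | a5 F G H => exact UEq.mul_assoc F G H
  | a7 _ => exact UEq.add_zero _
  | a8 _ => exact UEq.mul_zero _
  | a9 _ => exact UEq.mul_one _
  | _ => exact absurd (by simp [IsDistConst]) hs

/-- **ACU-soundness for `P_f`.** In a `P_f` proof with no instance of A6 or A10, every line relates
ACU-equivalent formulas. [folklore] -/
theorem uEq_of_pfProof {Γ : List (PIFormula 𝔽 X × PIFormula 𝔽 X)} (π : PFProof 𝔽 X Γ)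
    (h : ∀ s, IsDistConst s → π.axiomCount s = 0) :
    ∀ {F G : PIFormula 𝔽 X}, (F, G) ∈ Γ → UEq F G := by
  induction π with
  | nil => intro F G hm; simp at hm
  | axm s' hax π ih =>
    intro F G hm
    have hπ : ∀ s, IsDistConst s → π.axiomCount s = 0 := fun s hs => by
      have := h s hs; simp only [PIProof.axiomCount] at this; omega
    have hs' : ¬ IsDistConst s' := fun hs => by
      have := h s' hs; simp [PIProof.axiomCount] at this
    rcases List.mem_cons.1 hm with hm | hm
    · obtain ⟨rfl, rfl⟩ := Prod.mk.injEq _ _ _ _ ▸ hm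
      rcases hax with hax | hax
      · exact uEq_of_ringAxiom_pf hs' hax
      · exact hax.elim
    · exact ih hπ hm
  | symm hm' π ih =>
    intro F G hm
    rcases List.mem_cons.1 hm with hm | hm
    · obtain ⟨rfl, rfl⟩ := Prod.mk.injEq _ _ _ _ ▸ hm
      exact (ih h hm').symm
    · exact ih h hm
  | trans h₁ h₂ π ih =>
    intro F G hm
    rcases List.mem_cons.1 hm with hm | hm
    · obtain ⟨rfl, rfl⟩ := Prod.mk.injEq _ _ _ _ ▸ hm
      exact (ih h h₁).trans (ih h h₂)
    · exact ih h hm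
  | addRule h₁ h₂ hF hG π ih =>
    intro F G hm
    rcases List.mem_cons.1 hm with hm | hm
    · obtain ⟨rfl, rfl⟩ := Prod.mk.injEq _ _ _ _ ▸ hm
      subst hF hG
      exact UEq.add_congr (ih h h₁) (ih h h₂)
    · exact ih h hm
  | mulRule h₁ h₂ hF hG π ih =>
    intro F G hm
    rcases List.mem_cons.1 hm with hm | hm
    · obtain ⟨rfl, rfl⟩ := Prod.mk.injEq _ _ _ _ ▸ hm
      subst hF hG
      exact UEq.mul_congr (ih h h₁) (ih h h₂)
    · exact ih h hm

/-- `P_f`-provability within a budget vanishing on A6 and A10 forces ACU-equivalence. [folklore] -/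
theorem uEq_of_pfProvable {F G : PIFormula 𝔽 X} {b : PIAxiom → ℕ∞}
    (hb : ∀ s, IsDistConst s → b s = 0) (h : (pfSystem 𝔽 X).Provable F G ⊤ b) : UEq F G := by
  obtain ⟨Γ, π, -, hπ⟩ := h
  refine uEq_of_pfProof π (fun s hs => ?_) List.mem_cons_self
  have := hπ s
  rw [hb s hs, nonpos_iff_eq_zero, Nat.cast_eq_zero] at this
  exact this

/-! #### `P_c` -/

/-- An A1–A5 / A7–A9 instance on circuits relates circuits with ACU-equivalent unfoldings.
[folklore] -/
theorem uEq_unfold_of_ringAxiom {s : PIAxiom} (hs : ¬ IsDistConst s) {F G : PICircuit 𝔽 X}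
    (h : (pcSystem 𝔽 X).RingAxiom s F G) : UEq F.unfold G.unfold := by
  cases h with
  | a1 F => exact .refl _
  | a2 F G => simpa [pcSystem] using UEq.add_comm F.unfold G.unfold
  | a3 F G H => simpa [pcSystem] using UEq.add_assoc F.unfold G.unfold H.unfold
  | a4 F G => simpa [pcSystem] using UEq.mul_comm F.unfold G.unfold
  | a5 F G H => simpa [pcSystem] using UEq.mul_assoc F.unfold G.unfold H.unfold
  | a7 _ =>
    simp only [pcSystem, PICircuit.unfold_add, PICircuit.unfold_const]
    exact UEq.add_zero _
  | a8 _ =>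
    simp only [pcSystem, PICircuit.unfold_mul, PICircuit.unfold_const]
    exact UEq.mul_zero _
  | a9 _ =>
    simp only [pcSystem, PICircuit.unfold_mul, PICircuit.unfold_const]
    exact UEq.mul_one _
  | _ => exact absurd (by simp [IsDistConst]) hs

/-- **ACU-soundness for `P_c`.** In a `P_c` proof with no instance of A6 or A10, both sides of every
line unfold to ACU-equivalent formulas (C1/C2 instances have literally equal unfoldings).
[folklore] -/
theorem uEq_unfold_of_pcProof {Γ : List (PICircuit 𝔽 X × PICircuit 𝔽 X)} (π : PCProof 𝔽 X Γ)
    (h : ∀ s, IsDistConst s → π.axiomCount s = 0) :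
    ∀ {F G : PICircuit 𝔽 X}, (F, G) ∈ Γ → UEq F.unfold G.unfold := by
  induction π with
  | nil => intro F G hm; simp at hm
  | axm s' hax π ih =>
    intro F G hm
    have hπ : ∀ s, IsDistConst s → π.axiomCount s = 0 := fun s hs => by
      have := h s hs; simp only [PIProof.axiomCount] at this; omega
    have hs' : ¬ IsDistConst s' := fun hs => by
      have := h s' hs; simp [PIProof.axiomCount] at this
    rcases List.mem_cons.1 hm with hm | hm
    · obtain ⟨rfl, rfl⟩ := Prod.mk.injEq _ _ _ _ ▸ hm
      rcases hax with hax | hax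
      · exact uEq_unfold_of_ringAxiom hs' hax
      · rw [show F.unfold = G.unfold from PICircuit.IsExtra.unfold_eq hax]; exact .refl _
    · exact ih hπ hm
  | symm hm' π ih =>
    intro F G hm
    rcases List.mem_cons.1 hm with hm | hm
    · obtain ⟨rfl, rfl⟩ := Prod.mk.injEq _ _ _ _ ▸ hm
      exact (ih h hm').symm
    · exact ih h hm
  | trans h₁ h₂ π ih =>
    intro F G hm
    rcases List.mem_cons.1 hm with hm | hm
    · obtain ⟨rfl, rfl⟩ := Prod.mk.injEq _ _ _ _ ▸ hm
      exact (ih h h₁).trans (ih h h₂)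
    · exact ih h hm
  | addRule h₁ h₂ hF hG π ih =>
    intro F G hm
    rcases List.mem_cons.1 hm with hm | hm
    · obtain ⟨rfl, rfl⟩ := Prod.mk.injEq _ _ _ _ ▸ hm
      subst hF hG
      simpa [pcSystem] using UEq.add_congr (ih h h₁) (ih h h₂)
    · exact ih h hm
  | mulRule h₁ h₂ hF hG π ih =>
    intro F G hm
    rcases List.mem_cons.1 hm with hm | hm
    · obtain ⟨rfl, rfl⟩ := Prod.mk.injEq _ _ _ _ ▸ hm
      subst hF hG
      simpa [pcSystem] using UEq.mul_congr (ih h h₁) (ih h h₂)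
    · exact ih h hm

/-- If `F = G` has a `P_c` proof within a budget vanishing on A6 and A10, then `F` and `G` unfold
to ACU-equivalent formulas. [folklore] -/
theorem uEq_unfold_of_hasPCProof {F G : PICircuit 𝔽 X} {b : PIAxiom → ℕ∞}
    (hb : ∀ s, IsDistConst s → b s = 0) (h : HasPCProof F G b) : UEq F.unfold G.unfold := by
  obtain ⟨Γ, π, -, hπ⟩ := h
  refine uEq_unfold_of_pcProof π (fun s hs => ?_) List.mem_cons_self
  have := hπ s
  rw [hb s hs, nonpos_iff_eq_zero, Nat.cast_eq_zero] at this
  exact this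

end Sound

end ACStability

open Literature.Computability.AlgebraicComplexity in
/-- **ACU-soundness for the budget of rung S3‴** (helper under stub S2″ `stub_proofsToACEquiv`,
crux `RestorationQP`): a `P_c(ℂ)` proof of `F = G` using no instance of A6 (distributivity) or A10
(constant equations) — unit laws A7–A9 allowed — forces the unfoldings of `F` and `G` to be equal
modulo associativity, commutativity and the unit laws. [folklore] -/
theorem proofsToACEquiv_aux_unitSound : ∀ (n : ℕ) (F G : PICircuit ℂ (Fin n × Fin n)), HasPCProof F G (fun s => if s = PIAxiom.A6 ∨ s = PIAxiom.A10 then 0 else ⊤) → ACStability.UEq F.unfold G.unfold := by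
  intro n F G h
  exact ACStability.uEq_unfold_of_hasPCProof (fun s hs => if_pos hs) h

end Summit.ValiantsHypothesis.ValiantsHypothesis.Theorems
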